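import Literature.Analysis.Matrix.KyFanMaximumPrinciple
import Mathlib.Analysis.SpecialFunctions.Exp

/-!
# Multiband square-well superconductors: the anisotropic/isotropic `T_c` ratio grows with `μ*`

In the multiband (Suhl–Matthias–Walker) BCS-type square-well model with band weights
`w_i = N_i/N` (`Σ w = 1`), a symmetric pairing matrix `U_{ij}` and a Coulomb pseudopotential `μ`
that is CONSTANT over the Fermi surface, the linearised gap equation
`Δ_i = ln(Θ/T) Σ_j (U_{ij} − μ) w_j Δ_j` gives `T_c = Θ exp(−1/g)` with `g` the largest eigenvalue of the
symmetric matrix `M(μ) = A − μ b bᵀ`, `A = W^{1/2} U W^{1/2}`, `b = W^{1/2}𝟙` (a UNIT vector), while the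
Fermi-surface-averaged («isotropic», one-band) problem has `g_iso(μ) = bᵀ A b − μ = bᵀ M(μ) b`
[cite: SuhlMatthiasWalker1959]. The ratio of the two critical temperatures is
`R(μ) = T_c^aniso/T_c^iso = exp(1/g_iso(μ) − 1/g_aniso(μ))`.

THEOREM (this file): `R` is monotone NON-DECREASING in `μ` (on the domain `g_iso > 0`). Ingredients:
(i) `g_aniso ≥ g_iso` (Rayleigh: the compression onto `b`); (ii) `g_aniso` decreases with `μ` at a
RATE AT MOST ONE: `M(μ₁) = M(μ₂) + (μ₂−μ₁) b bᵀ ≼ M(μ₂) + (μ₂−μ₁)·1` because `b bᵀ ≼ 1` for a unit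
vector (Cauchy–Schwarz), hence `λ_max(M(μ₁)) ≤ λ_max(M(μ₂)) + (μ₂−μ₁)` (Weyl) — whereas `g_iso`
decreases at rate exactly one; (iii) the elementary inequality
`δ/(g_iso(μ₁) g_iso(μ₂)) ≥ (G₁ − G₂)/(G₁ G₂)` for `0 ≤ G₁ − G₂ ≤ δ`, `G ≥ g_iso > 0`.

Context: this is the square-well caricature of the «physics datum» used by the conventional-branch
cell (`pub/hubbard-eph`) to apply its own-anisotropy box μ*-MATCHED (the anisotropic/isotropic
Migdal–Eliashberg `T_c` ratio of MgB₂ rises from 2.23 at μ* = 0.10 to 3.15 at μ* = 0.16 in the cell's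
EPW runs, and from 1.71 to 2.38 in a two-band Eliashberg model); here it is a theorem for every
multiband square-well model, with no assumption on `U` beyond symmetry.

Proved here:
* `couplingMatrix`, `isHermitian_couplingMatrix` — `M(μ) = A − μ · b bᵀ`;
* `gIso_le_eigenvalues₀_max` — (i);
* `eigenvalues₀_max_couplingMatrix_antitone`, `eigenvalues₀_max_couplingMatrix_sub_le` — `g_aniso`
  is antitone in `μ` and drops by at most `μ₂ − μ₁` (ii);
* `inv_gIso_sub_inv_gAniso_mono` — **`μ ↦ 1/g_iso(μ) − 1/g_aniso(μ)` is monotone** (iii);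
* `tcRatio_mono` — `R(μ) = exp(1/g_iso − 1/g_aniso)` is monotone non-decreasing in `μ`.

## References
* [SuhlMatthiasWalker1959] H. Suhl, B. T. Matthias, L. R. Walker, Phys. Rev. Lett. 3 (1959) 552 —
  multiband BCS gap equation and its `T_c` (largest-eigenvalue form).
* [HornJohnson2013] R. A. Horn, C. R. Johnson, *Matrix Analysis*, 2nd ed. — Thm. 4.2.2 (Rayleigh),
  Cor. 4.3.12 (Weyl monotonicity).
-/

noncomputable section

open scoped Matrix

namespace Literature.MathematicalPhysics.QuantumManyBody

open Finset _root_.Matrix Literature.Analysis.Matrix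

variable {ι : Type*} [Fintype ι] [DecidableEq ι]

/-- **The multiband square-well coupling matrix** `M(μ) = A − μ · b bᵀ` (`A = W^{1/2} U W^{1/2}` the
weighted pairing matrix, `b = W^{1/2}𝟙` the unit weight vector, `μ` the Coulomb pseudopotential);
`T_c^aniso = Θ exp(−1/λ_max(M(μ)))`. [cite: SuhlMatthiasWalker1959] -/
def couplingMatrix (A : Matrix ι ι ℝ) (b : ι → ℝ) (μ : ℝ) : Matrix ι ι ℝ :=
  A - μ • vecMulVec b b

/-- The Fermi-surface-averaged (one-band) coupling `g_iso(μ) = bᵀ A b − μ`.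
[cite: SuhlMatthiasWalker1959] -/
def gIso (A : Matrix ι ι ℝ) (b : ι → ℝ) (μ : ℝ) : ℝ := b ⬝ᵥ A *ᵥ b - μ

omit [Fintype ι] [DecidableEq ι] in
/-- `M(μ)` is symmetric when `A` is. [cite: SuhlMatthiasWalker1959] -/
theorem isHermitian_couplingMatrix {A : Matrix ι ι ℝ} (hA : A.IsHermitian) (b : ι → ℝ) (μ : ℝ) :
    (couplingMatrix A b μ).IsHermitian := by
  unfold couplingMatrix
  refine hA.sub ?_
  unfold Matrix.IsHermitian
  rw [conjTranspose_eq_transpose_of_trivial, transpose_smul, transpose_vecMulVec]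

omit [DecidableEq ι] in
/-- `(b bᵀ) x = (b ⬝ x) b`. [folklore] -/
private theorem vecMulVec_mulVec' (b x : ι → ℝ) : vecMulVec b b *ᵥ x = (b ⬝ᵥ x) • b := by
  ext i
  simp only [mulVec, dotProduct, vecMulVec_apply, Pi.smul_apply, smul_eq_mul, Finset.sum_mul]
  exact Finset.sum_congr rfl fun j _ => by ring

omit [DecidableEq ι] in
/-- Quadratic form of `M(μ)`: `xᵀ M(μ) x = xᵀ A x − μ (b ⬝ x)²`. [folklore] -/
private theorem dotProduct_couplingMatrix_mulVec (A : Matrix ι ι ℝ) (b : ι → ℝ) (μ : ℝ) (x : ι → ℝ) :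
    x ⬝ᵥ couplingMatrix A b μ *ᵥ x = x ⬝ᵥ A *ᵥ x - μ * (b ⬝ᵥ x) ^ 2 := by
  unfold couplingMatrix
  rw [sub_mulVec, dotProduct_sub, smul_mulVec, vecMulVec_mulVec', dotProduct_smul, dotProduct_smul,
    smul_eq_mul, smul_eq_mul, dotProduct_comm x b]
  ring

omit [DecidableEq ι] in
/-- For a unit weight vector, `g_iso(μ) = bᵀ M(μ) b` — the isotropic coupling is the compression of
`M(μ)` onto `b`. [cite: SuhlMatthiasWalker1959] -/
theorem gIso_eq_dotProduct (A : Matrix ι ι ℝ) {b : ι → ℝ} (hb : b ⬝ᵥ b = 1) (μ : ℝ) :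
    gIso A b μ = b ⬝ᵥ couplingMatrix A b μ *ᵥ b := by
  rw [dotProduct_couplingMatrix_mulVec, hb, gIso]; ring

/-- **(i) `g_iso ≤ g_aniso`**: the averaged coupling is a Rayleigh quotient of `M(μ)` at the unit vector
`b`, hence at most the top eigenvalue. [cite: HornJohnson2013, Thm. 4.2.2] -/
theorem gIso_le_eigenvalues₀_max {A : Matrix ι ι ℝ} (hA : A.IsHermitian) {b : ι → ℝ} (hb : b ⬝ᵥ b = 1)
    (μ : ℝ) (hn : 1 ≤ Fintype.card ι) :
    gIso A b μ ≤ (isHermitian_couplingMatrix hA b μ).eigenvalues₀ (Fin.castLE hn 0) := by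
  have h := KyFan.dotProduct_mulVec_le_eigenvalues₀_max_mul (isHermitian_couplingMatrix hA b μ) hn b
  rw [hb, mul_one, ← gIso_eq_dotProduct A hb μ] at h
  exact h

omit [Fintype ι] [DecidableEq ι] in
/-- Increment of the family: `M(μ₁) = M(μ₂) + (μ₂ − μ₁) · b bᵀ`. [folklore] -/
private theorem couplingMatrix_eq_add (A : Matrix ι ι ℝ) (b : ι → ℝ) (μ₁ μ₂ : ℝ) :
    couplingMatrix A b μ₁ = couplingMatrix A b μ₂ + (μ₂ - μ₁) • vecMulVec b b := by
  unfold couplingMatrix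
  rw [sub_smul, sub_add_sub_cancel]

/-- **`g_aniso` is antitone in `μ`** (Weyl: `M(μ₁) − M(μ₂) = (μ₂−μ₁) b bᵀ ≽ 0`).
[cite: HornJohnson2013, Cor. 4.3.12] -/
theorem eigenvalues₀_max_couplingMatrix_antitone {A : Matrix ι ι ℝ} (hA : A.IsHermitian) (b : ι → ℝ)
    {μ₁ μ₂ : ℝ} (h : μ₁ ≤ μ₂) (j : Fin (Fintype.card ι)) :
    (isHermitian_couplingMatrix hA b μ₂).eigenvalues₀ j ≤
      (isHermitian_couplingMatrix hA b μ₁).eigenvalues₀ j := by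
  have hsum : (couplingMatrix A b μ₂ + (μ₂ - μ₁) • vecMulVec b b).IsHermitian := by
    rw [← couplingMatrix_eq_add]; exact isHermitian_couplingMatrix hA b μ₁
  have hpsd : ∀ x : ι → ℝ, 0 ≤ x ⬝ᵥ ((μ₂ - μ₁) • vecMulVec b b) *ᵥ x := fun x => by
    rw [smul_mulVec, vecMulVec_mulVec', dotProduct_smul, dotProduct_smul, smul_eq_mul, smul_eq_mul,
      dotProduct_comm x b]
    nlinarith [sq_nonneg (b ⬝ᵥ x)]
  have key := KyFan.eigenvalues₀_le_of_add_psd (isHermitian_couplingMatrix hA b μ₂) hsum hpsd j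
  have heq : hsum.eigenvalues₀ = (isHermitian_couplingMatrix hA b μ₁).eigenvalues₀ := by
    congr 1; exact (couplingMatrix_eq_add A b μ₁ μ₂).symm
  rw [heq] at key
  exact key

/-- **(ii) `g_aniso` drops at a rate at most one**: for a UNIT vector `b` and `μ₁ ≤ μ₂`,
`λ_j(M(μ₁)) ≤ λ_j(M(μ₂)) + (μ₂ − μ₁)` for every sorted eigenvalue — because
`(μ₂−μ₁)(1 − b bᵀ) ≽ 0` (Cauchy–Schwarz `(b ⬝ x)² ≤ (b ⬝ b)(x ⬝ x) = x ⬝ x`) and Weyl's monotonicity,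
followed by `λ_j(W + c·1) = λ_j(W) + c`. [cite: HornJohnson2013, Cor. 4.3.12] -/
theorem eigenvalues₀_max_couplingMatrix_sub_le {A : Matrix ι ι ℝ} (hA : A.IsHermitian) {b : ι → ℝ}
    (hb : b ⬝ᵥ b = 1) {μ₁ μ₂ : ℝ} (h : μ₁ ≤ μ₂) (j : Fin (Fintype.card ι)) :
    (isHermitian_couplingMatrix hA b μ₁).eigenvalues₀ j ≤
      (isHermitian_couplingMatrix hA b μ₂).eigenvalues₀ j + (μ₂ - μ₁) := by
  set δ := μ₂ - μ₁ with hδ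
  have hδ0 : 0 ≤ δ := by rw [hδ]; linarith
  -- M(μ₂) + δ·1 = M(μ₁) + δ(1 − b bᵀ)
  have hone : (δ • (1 : Matrix ι ι ℝ)).IsHermitian := by
    unfold Matrix.IsHermitian
    rw [conjTranspose_eq_transpose_of_trivial, transpose_smul, transpose_one]
  have hshift : (couplingMatrix A b μ₂ + δ • (1 : Matrix ι ι ℝ)).IsHermitian :=
    (isHermitian_couplingMatrix hA b μ₂).add hone
  have hsum : (couplingMatrix A b μ₁ + δ • ((1 : Matrix ι ι ℝ) - vecMulVec b b)).IsHermitian := by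
    have : couplingMatrix A b μ₁ + δ • ((1 : Matrix ι ι ℝ) - vecMulVec b b) =
        couplingMatrix A b μ₂ + δ • (1 : Matrix ι ι ℝ) := by
      rw [couplingMatrix_eq_add A b μ₁ μ₂, smul_sub]; abel
    rw [this]; exact hshift
  have hpsd : ∀ x : ι → ℝ, 0 ≤ x ⬝ᵥ (δ • ((1 : Matrix ι ι ℝ) - vecMulVec b b)) *ᵥ x := fun x => by
    rw [smul_mulVec, dotProduct_smul, sub_mulVec, one_mulVec, dotProduct_sub, vecMulVec_mulVec',
      dotProduct_smul, smul_eq_mul, smul_eq_mul, dotProduct_comm x b]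
    -- Cauchy–Schwarz: (b⬝x)^2 ≤ (b⬝b)(x⬝x) = x⬝x
    have e2 : b ⬝ᵥ b = ∑ i, b i ^ 2 := by simp only [dotProduct, sq]
    have e3 : x ⬝ᵥ x = ∑ i, x i ^ 2 := by simp only [dotProduct, sq]
    have hcs : (b ⬝ᵥ x) ^ 2 ≤ (b ⬝ᵥ b) * (x ⬝ᵥ x) := by
      rw [e2, e3]
      exact Finset.sum_mul_sq_le_sq_mul_sq Finset.univ b x
    rw [hb, one_mul] at hcs
    nlinarith [hcs, sq_nonneg (b ⬝ᵥ x)]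
  have key := KyFan.eigenvalues₀_le_of_add_psd (isHermitian_couplingMatrix hA b μ₁) hsum hpsd j
  have heq : hsum.eigenvalues₀ = hshift.eigenvalues₀ := by
    congr 1; rw [couplingMatrix_eq_add A b μ₁ μ₂, smul_sub]; abel
  rw [heq, KyFan.eigenvalues₀_add_smul_one (isHermitian_couplingMatrix hA b μ₂) δ hshift j] at key
  exact key

/-- **(iii) The exponent difference is monotone**: for a unit weight vector `b`, `μ₁ ≤ μ₂` and
`g_iso(μ₂) > 0` (so all four couplings are positive),
`1/g_iso(μ₁) − 1/g_aniso(μ₁) ≤ 1/g_iso(μ₂) − 1/g_aniso(μ₂)`.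
[cite: SuhlMatthiasWalker1959] -/
theorem inv_gIso_sub_inv_gAniso_mono {A : Matrix ι ι ℝ} (hA : A.IsHermitian) {b : ι → ℝ}
    (hb : b ⬝ᵥ b = 1) {μ₁ μ₂ : ℝ} (h : μ₁ ≤ μ₂) (hn : 1 ≤ Fintype.card ι) (hpos : 0 < gIso A b μ₂) :
    1 / gIso A b μ₁ - 1 / (isHermitian_couplingMatrix hA b μ₁).eigenvalues₀ (Fin.castLE hn 0) ≤
      1 / gIso A b μ₂ - 1 / (isHermitian_couplingMatrix hA b μ₂).eigenvalues₀ (Fin.castLE hn 0) := by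
  set g₁ := gIso A b μ₁ with hg₁
  set g₂ := gIso A b μ₂ with hg₂
  set G₁ := (isHermitian_couplingMatrix hA b μ₁).eigenvalues₀ (Fin.castLE hn 0) with hG₁
  set G₂ := (isHermitian_couplingMatrix hA b μ₂).eigenvalues₀ (Fin.castLE hn 0) with hG₂
  have hg : g₁ = g₂ + (μ₂ - μ₁) := by simp only [hg₁, hg₂, gIso]; ring
  have hG₂g : g₂ ≤ G₂ := gIso_le_eigenvalues₀_max hA hb μ₂ hn
  have hG₁g : g₁ ≤ G₁ := gIso_le_eigenvalues₀_max hA hb μ₁ hn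
  have hGanti : G₂ ≤ G₁ := eigenvalues₀_max_couplingMatrix_antitone hA b h _
  have hGrate : G₁ ≤ G₂ + (μ₂ - μ₁) := eigenvalues₀_max_couplingMatrix_sub_le hA hb h _
  have hg₂pos : 0 < g₂ := hpos
  have hg₁pos : 0 < g₁ := by rw [hg]; linarith
  have hG₁pos : 0 < G₁ := lt_of_lt_of_le hg₁pos hG₁g
  have hG₂pos : 0 < G₂ := lt_of_lt_of_le hg₂pos hG₂g
  -- 1/g₁ − 1/G₁ ≤ 1/g₂ − 1/G₂  ⟺  1/G₂ − 1/G₁ ≤ 1/g₂ − 1/g₁ = δ/(g₁g₂), and 1/G₂ − 1/G₁ = (G₁−G₂)/(G₁G₂) ≤ δ/(G₁G₂) ≤ δ/(g₁g₂)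
  rw [div_sub_div _ _ hg₁pos.ne' hG₁pos.ne', div_sub_div _ _ hg₂pos.ne' hG₂pos.ne',
    div_le_div_iff₀ (mul_pos hg₁pos hG₁pos) (mul_pos hg₂pos hG₂pos)]
  -- goal: (1*G₁ - g₁*1) * (g₂*G₂) ≤ (1*G₂ - g₂*1) * (g₁*G₁); RHS − LHS = G₁G₂δ − g₁g₂(G₁ − G₂) ≥ 0
  have P1 : g₁ * g₂ * (G₁ - G₂) ≤ g₁ * g₂ * (μ₂ - μ₁) :=
    mul_le_mul_of_nonneg_left (by linarith) (mul_nonneg hg₁pos.le hg₂pos.le)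
  have P2 : g₁ * g₂ ≤ G₁ * G₂ := mul_le_mul hG₁g hG₂g hg₂pos.le hG₁pos.le
  have P3 : g₁ * g₂ * (μ₂ - μ₁) ≤ G₁ * G₂ * (μ₂ - μ₁) := mul_le_mul_of_nonneg_right P2 (by linarith)
  have h1 : (G₁ - g₁) * (g₂ * G₂) ≤ (G₂ - g₂) * (g₁ * G₁) := by
    have hid : (G₂ - g₂) * (g₁ * G₁) - (G₁ - g₁) * (g₂ * G₂) =
        G₁ * G₂ * (g₁ - g₂) - g₁ * g₂ * (G₁ - G₂) := by ring
    have hδ : g₁ - g₂ = μ₂ - μ₁ := by rw [hg]; ring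
    have P4 : G₁ * G₂ * (g₁ - g₂) = G₁ * G₂ * (μ₂ - μ₁) := by rw [hδ]
    nlinarith [P1, P3, hid, P4]
  linarith [h1]

/-- **The anisotropic/isotropic `T_c` ratio grows with `μ*`** in every multiband square-well model:
with `T_c = Θ exp(−1/g)`, `R(μ) = T_c^aniso/T_c^iso = exp(1/g_iso(μ) − 1/g_aniso(μ))` is monotone
non-decreasing in `μ` on the domain `g_iso > 0` — the «μ*-matching» datum of multiband `T_c` boxes
as a theorem of the square-well model. [cite: SuhlMatthiasWalker1959] -/
theorem tcRatio_mono {A : Matrix ι ι ℝ} (hA : A.IsHermitian) {b : ι → ℝ} (hb : b ⬝ᵥ b = 1)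
    {μ₁ μ₂ : ℝ} (h : μ₁ ≤ μ₂) (hn : 1 ≤ Fintype.card ι) (hpos : 0 < gIso A b μ₂) :
    Real.exp (1 / gIso A b μ₁ - 1 / (isHermitian_couplingMatrix hA b μ₁).eigenvalues₀ (Fin.castLE hn 0)) ≤
      Real.exp (1 / gIso A b μ₂ - 1 / (isHermitian_couplingMatrix hA b μ₂).eigenvalues₀ (Fin.castLE hn 0)) :=
  Real.exp_le_exp.mpr (inv_gIso_sub_inv_gAniso_mono hA hb h hn hpos)

end Literature.MathematicalPhysics.QuantumManyBody

end
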